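import Summits.MatrixMultiplication.OmegaCensus.ThreeSetPairZ4Z4
import Summits.MatrixMultiplication.OmegaCensus.ThreeSetPairZ4Z4Tables
import Summits.MatrixMultiplication.OmegaCensus.ThreeSetPairZ4Z4Tables77A
import Summits.MatrixMultiplication.OmegaCensus.ThreeSetPairZ4Z4Tables77B
import Summits.MatrixMultiplication.OmegaCensus.DominoUniformZ4Z4Cells
import Summits.MatrixMultiplication.OmegaCensus.DominoPartFiveZ4Z4Cells
import HarnessLib

/-!
# The three-set cube cells `(3,5,e)`, `(5,5,e)`, `(7,7,e)` over `A ↠ ℤ₄ × ℤ₄`; orders `496`, `736`, `976`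

ω-census `pub-omega`, family (b3), seat pub-omega-group gen 17.  Framing: lottery ticket; floor = certified bounds/negative
ranges.  VALUE: kernel theorems about the group-theoretic method (TPP capacity of dihedral-like groups) — the last three
open cells `≤ 1000` of the Dih classification over groups with a `ℤ₄ × ℤ₄` quotient; NOT progress on ω.

* `no_cube_form_35/55/77_of_onto_z4z4`: no three-set shifted form over `A ↠ ℤ₄²` with `(|W|, |X|) = (3,5), (5,5), (7,7)`
  and `Y` arbitrary (`three_set_pair_reduction` + the profile tables `three_set_table_3_5 / _5_5 / _7_7_*`).
* `no_law_cube_35e/55e/77e_of_onto_z4z4` and the order-free cell forms: no TPP triple in a dihedral-like group over such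
  `A` (any `c₀`) with balanced coset parts containing parts `3` and `5`, or two parts `5`, or two parts `7`, attains
  `3|S||T||U| + 8 = 8|A|` (all orderings, by `TripleProductProperty.rotate` / `tpp_reverse`).
* `no_mod_one_law_of_onto_z4z4_threeset`: the factorisation criterion of `no_mod_one_law_of_onto_z4z4_domino` extended by
  these escapes; ORDERS **`496 = 3·(3·5·11)+1`, `736 = 3·(5·7·7)+1`, `976 = 3·(5·5·13)+1`**:
  `no_mod_one_law_card_496/736/976_of_onto_z4z4` and the instances `ℤ₄²×ℤ₃₁`, `ℤ₄×ℤ₈×ℤ₂₃`, `ℤ₄²×ℤ₆₁` — census cells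
  `(3,5,11)@496`, `(5,7,7)@736`, `(5,5,13)@976` (the three 'three-set shape over `ℤ₄²`' cells of CLASSIFICATION-STATUS-g16)
  are KERNEL, and with them every cell `≤ 1000` of a group with a `ℤ₄²` quotient.
-/

namespace Summit.MatrixMultiplication.OmegaCensus

open Finset

/-! ## Core: the three excluded profile shapes -/

section Core

variable {A : Type*} [AddCommGroup A] [Fintype A] [DecidableEq A]

/-- **No three-set form with `|W| = 3`, `|X| = 5` over `A ↠ ℤ₄²`.** [folklore] -/
theorem no_cube_form_35_of_onto_z4z4 (Φ : A →+ ZMod 4 × ZMod 4) (hΦ : Function.Surjective Φ)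
    {W X Y : Finset A} {κ₁ κ₂ κ₃ x₀ : A} (hW : W.card = 3) (hX : X.card = 5)
    (i₁ : Set.InjOn (fun p : A × A × A => p.1 + p.2.1 + p.2.2) ↑((W.image fun w => κ₁ - w) ×ˢ X ×ˢ Y))
    (i₂ : Set.InjOn (fun p : A × A × A => p.1 + p.2.1 + p.2.2) ↑(W ×ˢ (X.image fun x => κ₂ - x) ×ˢ Y))
    (i₃ : Set.InjOn (fun p : A × A × A => p.1 + p.2.1 + p.2.2) ↑(W ×ˢ X ×ˢ (Y.image fun y => κ₃ - y)))
    (d₁₂ : Disjoint (((W.image fun w => κ₁ - w) ×ˢ X ×ˢ Y).image fun p : A × A × A => p.1 + p.2.1 + p.2.2)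
      ((W ×ˢ (X.image fun x => κ₂ - x) ×ˢ Y).image fun p : A × A × A => p.1 + p.2.1 + p.2.2))
    (d₁₃ : Disjoint (((W.image fun w => κ₁ - w) ×ˢ X ×ˢ Y).image fun p : A × A × A => p.1 + p.2.1 + p.2.2)
      ((W ×ˢ X ×ˢ (Y.image fun y => κ₃ - y)).image fun p : A × A × A => p.1 + p.2.1 + p.2.2))
    (d₂₃ : Disjoint ((W ×ˢ (X.image fun x => κ₂ - x) ×ˢ Y).image fun p : A × A × A => p.1 + p.2.1 + p.2.2)
      ((W ×ˢ X ×ˢ (Y.image fun y => κ₃ - y)).image fun p : A × A × A => p.1 + p.2.1 + p.2.2))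
    (hcover : (((W.image fun w => κ₁ - w) ×ˢ X ×ˢ Y).image fun p : A × A × A => p.1 + p.2.1 + p.2.2) ∪
      ((W ×ˢ (X.image fun x => κ₂ - x) ×ˢ Y).image fun p : A × A × A => p.1 + p.2.1 + p.2.2) ∪
      ((W ×ˢ X ×ˢ (Y.image fun y => κ₃ - y)).image fun p : A × A × A => p.1 + p.2.1 + p.2.2) = univ.erase x₀) :
    False := by
  obtain ⟨P₀, M₀, P₁, M₁, P₂, M₂, P₃, M₃, S₀, T₀, S₁, T₁, S₂, T₂, S₃, T₃, l, l₂, b, b', hsW, hsX, hAW, hB1W, hB2W,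
    hAX, hB1X, hB2X, hl₂, E1, E2⟩ := three_set_pair_reduction Φ hΦ i₁ i₂ i₃ d₁₂ d₁₃ d₂₃ hcover
  rw [hW] at hsW
  rw [hX] at hsX
  rcases three_set_table_3_5 (P₀ + M₀, P₁ + M₁ + (P₂ + M₂ + (P₃ + M₃)))
      (by simp only [List.Nat.mem_antidiagonal]; omega)
      (P₁ + M₁, P₂ + M₂ + (P₃ + M₃)) (by simp only [List.Nat.mem_antidiagonal])
      (P₂ + M₂, P₃ + M₃) (by simp only [List.Nat.mem_antidiagonal]) hAW
      (P₀, M₀) (by simp only [List.Nat.mem_antidiagonal]) (P₁, M₁) (by simp only [List.Nat.mem_antidiagonal])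
      (P₂, M₂) (by simp only [List.Nat.mem_antidiagonal]) (P₃, M₃) (by simp only [List.Nat.mem_antidiagonal]) hB1W hB2W
      (S₀ + T₀, S₁ + T₁ + (S₂ + T₂ + (S₃ + T₃)))
      (by simp only [List.Nat.mem_antidiagonal]; omega)
      (S₁ + T₁, S₂ + T₂ + (S₃ + T₃)) (by simp only [List.Nat.mem_antidiagonal])
      (S₂ + T₂, S₃ + T₃) (by simp only [List.Nat.mem_antidiagonal]) hAX
      (S₀, T₀) (by simp only [List.Nat.mem_antidiagonal]) (S₁, T₁) (by simp only [List.Nat.mem_antidiagonal])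
      (S₂, T₂) (by simp only [List.Nat.mem_antidiagonal]) (S₃, T₃) (by simp only [List.Nat.mem_antidiagonal]) hB1X hB2X
      l with hk | hk
  · exact false_of_kill3 E1 hk
  · exact false_of_kill3 E2 (hk l₂ hl₂)

/-- **No three-set form with `|W| = 5`, `|X| = 5` over `A ↠ ℤ₄²`.** [folklore] -/
theorem no_cube_form_55_of_onto_z4z4 (Φ : A →+ ZMod 4 × ZMod 4) (hΦ : Function.Surjective Φ)
    {W X Y : Finset A} {κ₁ κ₂ κ₃ x₀ : A} (hW : W.card = 5) (hX : X.card = 5)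
    (i₁ : Set.InjOn (fun p : A × A × A => p.1 + p.2.1 + p.2.2) ↑((W.image fun w => κ₁ - w) ×ˢ X ×ˢ Y))
    (i₂ : Set.InjOn (fun p : A × A × A => p.1 + p.2.1 + p.2.2) ↑(W ×ˢ (X.image fun x => κ₂ - x) ×ˢ Y))
    (i₃ : Set.InjOn (fun p : A × A × A => p.1 + p.2.1 + p.2.2) ↑(W ×ˢ X ×ˢ (Y.image fun y => κ₃ - y)))
    (d₁₂ : Disjoint (((W.image fun w => κ₁ - w) ×ˢ X ×ˢ Y).image fun p : A × A × A => p.1 + p.2.1 + p.2.2)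
      ((W ×ˢ (X.image fun x => κ₂ - x) ×ˢ Y).image fun p : A × A × A => p.1 + p.2.1 + p.2.2))
    (d₁₃ : Disjoint (((W.image fun w => κ₁ - w) ×ˢ X ×ˢ Y).image fun p : A × A × A => p.1 + p.2.1 + p.2.2)
      ((W ×ˢ X ×ˢ (Y.image fun y => κ₃ - y)).image fun p : A × A × A => p.1 + p.2.1 + p.2.2))
    (d₂₃ : Disjoint ((W ×ˢ (X.image fun x => κ₂ - x) ×ˢ Y).image fun p : A × A × A => p.1 + p.2.1 + p.2.2)
      ((W ×ˢ X ×ˢ (Y.image fun y => κ₃ - y)).image fun p : A × A × A => p.1 + p.2.1 + p.2.2))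
    (hcover : (((W.image fun w => κ₁ - w) ×ˢ X ×ˢ Y).image fun p : A × A × A => p.1 + p.2.1 + p.2.2) ∪
      ((W ×ˢ (X.image fun x => κ₂ - x) ×ˢ Y).image fun p : A × A × A => p.1 + p.2.1 + p.2.2) ∪
      ((W ×ˢ X ×ˢ (Y.image fun y => κ₃ - y)).image fun p : A × A × A => p.1 + p.2.1 + p.2.2) = univ.erase x₀) :
    False := by
  obtain ⟨P₀, M₀, P₁, M₁, P₂, M₂, P₃, M₃, S₀, T₀, S₁, T₁, S₂, T₂, S₃, T₃, l, l₂, b, b', hsW, hsX, hAW, hB1W, hB2W,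
    hAX, hB1X, hB2X, hl₂, E1, E2⟩ := three_set_pair_reduction Φ hΦ i₁ i₂ i₃ d₁₂ d₁₃ d₂₃ hcover
  rw [hW] at hsW
  rw [hX] at hsX
  rcases three_set_table_5_5 (P₀ + M₀, P₁ + M₁ + (P₂ + M₂ + (P₃ + M₃)))
      (by simp only [List.Nat.mem_antidiagonal]; omega)
      (P₁ + M₁, P₂ + M₂ + (P₃ + M₃)) (by simp only [List.Nat.mem_antidiagonal])
      (P₂ + M₂, P₃ + M₃) (by simp only [List.Nat.mem_antidiagonal]) hAW
      (P₀, M₀) (by simp only [List.Nat.mem_antidiagonal]) (P₁, M₁) (by simp only [List.Nat.mem_antidiagonal])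
      (P₂, M₂) (by simp only [List.Nat.mem_antidiagonal]) (P₃, M₃) (by simp only [List.Nat.mem_antidiagonal]) hB1W hB2W
      (S₀ + T₀, S₁ + T₁ + (S₂ + T₂ + (S₃ + T₃)))
      (by simp only [List.Nat.mem_antidiagonal]; omega)
      (S₁ + T₁, S₂ + T₂ + (S₃ + T₃)) (by simp only [List.Nat.mem_antidiagonal])
      (S₂ + T₂, S₃ + T₃) (by simp only [List.Nat.mem_antidiagonal]) hAX
      (S₀, T₀) (by simp only [List.Nat.mem_antidiagonal]) (S₁, T₁) (by simp only [List.Nat.mem_antidiagonal])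
      (S₂, T₂) (by simp only [List.Nat.mem_antidiagonal]) (S₃, T₃) (by simp only [List.Nat.mem_antidiagonal]) hB1X hB2X
      l with hk | hk
  · exact false_of_kill3 E1 hk
  · exact false_of_kill3 E2 (hk l₂ hl₂)

/-- **No three-set form with `|W| = 7`, `|X| = 7` over `A ↠ ℤ₄²`.** [folklore] -/
theorem no_cube_form_77_of_onto_z4z4 (Φ : A →+ ZMod 4 × ZMod 4) (hΦ : Function.Surjective Φ)
    {W X Y : Finset A} {κ₁ κ₂ κ₃ x₀ : A} (hW : W.card = 7) (hX : X.card = 7)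
    (i₁ : Set.InjOn (fun p : A × A × A => p.1 + p.2.1 + p.2.2) ↑((W.image fun w => κ₁ - w) ×ˢ X ×ˢ Y))
    (i₂ : Set.InjOn (fun p : A × A × A => p.1 + p.2.1 + p.2.2) ↑(W ×ˢ (X.image fun x => κ₂ - x) ×ˢ Y))
    (i₃ : Set.InjOn (fun p : A × A × A => p.1 + p.2.1 + p.2.2) ↑(W ×ˢ X ×ˢ (Y.image fun y => κ₃ - y)))
    (d₁₂ : Disjoint (((W.image fun w => κ₁ - w) ×ˢ X ×ˢ Y).image fun p : A × A × A => p.1 + p.2.1 + p.2.2)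
      ((W ×ˢ (X.image fun x => κ₂ - x) ×ˢ Y).image fun p : A × A × A => p.1 + p.2.1 + p.2.2))
    (d₁₃ : Disjoint (((W.image fun w => κ₁ - w) ×ˢ X ×ˢ Y).image fun p : A × A × A => p.1 + p.2.1 + p.2.2)
      ((W ×ˢ X ×ˢ (Y.image fun y => κ₃ - y)).image fun p : A × A × A => p.1 + p.2.1 + p.2.2))
    (d₂₃ : Disjoint ((W ×ˢ (X.image fun x => κ₂ - x) ×ˢ Y).image fun p : A × A × A => p.1 + p.2.1 + p.2.2)
      ((W ×ˢ X ×ˢ (Y.image fun y => κ₃ - y)).image fun p : A × A × A => p.1 + p.2.1 + p.2.2))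
    (hcover : (((W.image fun w => κ₁ - w) ×ˢ X ×ˢ Y).image fun p : A × A × A => p.1 + p.2.1 + p.2.2) ∪
      ((W ×ˢ (X.image fun x => κ₂ - x) ×ˢ Y).image fun p : A × A × A => p.1 + p.2.1 + p.2.2) ∪
      ((W ×ˢ X ×ˢ (Y.image fun y => κ₃ - y)).image fun p : A × A × A => p.1 + p.2.1 + p.2.2) = univ.erase x₀) :
    False := by
  obtain ⟨P₀, M₀, P₁, M₁, P₂, M₂, P₃, M₃, S₀, T₀, S₁, T₁, S₂, T₂, S₃, T₃, l, l₂, b, b', hsW, hsX, hAW, hB1W, hB2W,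
    hAX, hB1X, hB2X, hl₂, E1, E2⟩ := three_set_pair_reduction Φ hΦ i₁ i₂ i₃ d₁₂ d₁₃ d₂₃ hcover
  rw [hW] at hsW
  rw [hX] at hsX
  have hm₀ : (P₀ + M₀, P₁ + M₁ + (P₂ + M₂ + (P₃ + M₃))) ∈ List.Nat.antidiagonal 7 := by
    simp only [List.Nat.mem_antidiagonal]; omega
  have hm₁ : (P₁ + M₁, P₂ + M₂ + (P₃ + M₃)) ∈ List.Nat.antidiagonal (P₀ + M₀, P₁ + M₁ + (P₂ + M₂ + (P₃ + M₃))).2 := by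
    simp only [List.Nat.mem_antidiagonal]
  have hm₂ : (P₂ + M₂, P₃ + M₃) ∈ List.Nat.antidiagonal (P₁ + M₁, P₂ + M₂ + (P₃ + M₃)).2 := by
    simp only [List.Nat.mem_antidiagonal]
  have hq₀ : (P₀, M₀) ∈ List.Nat.antidiagonal (P₀ + M₀, P₁ + M₁ + (P₂ + M₂ + (P₃ + M₃))).1 := by
    simp only [List.Nat.mem_antidiagonal]
  have hq₁ : (P₁, M₁) ∈ List.Nat.antidiagonal (P₁ + M₁, P₂ + M₂ + (P₃ + M₃)).1 := by
    simp only [List.Nat.mem_antidiagonal]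
  have hq₂ : (P₂, M₂) ∈ List.Nat.antidiagonal (P₂ + M₂, P₃ + M₃).1 := by simp only [List.Nat.mem_antidiagonal]
  have hq₃ : (P₃, M₃) ∈ List.Nat.antidiagonal (P₂ + M₂, P₃ + M₃).2 := by simp only [List.Nat.mem_antidiagonal]
  have hn₀ : (S₀ + T₀, S₁ + T₁ + (S₂ + T₂ + (S₃ + T₃))) ∈ List.Nat.antidiagonal 7 := by
    simp only [List.Nat.mem_antidiagonal]; omega
  have hn₁ : (S₁ + T₁, S₂ + T₂ + (S₃ + T₃)) ∈ List.Nat.antidiagonal (S₀ + T₀, S₁ + T₁ + (S₂ + T₂ + (S₃ + T₃))).2 := by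
    simp only [List.Nat.mem_antidiagonal]
  have hn₂ : (S₂ + T₂, S₃ + T₃) ∈ List.Nat.antidiagonal (S₁ + T₁, S₂ + T₂ + (S₃ + T₃)).2 := by
    simp only [List.Nat.mem_antidiagonal]
  have hs₀ : (S₀, T₀) ∈ List.Nat.antidiagonal (S₀ + T₀, S₁ + T₁ + (S₂ + T₂ + (S₃ + T₃))).1 := by
    simp only [List.Nat.mem_antidiagonal]
  have hs₁ : (S₁, T₁) ∈ List.Nat.antidiagonal (S₁ + T₁, S₂ + T₂ + (S₃ + T₃)).1 := by
    simp only [List.Nat.mem_antidiagonal]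
  have hs₂ : (S₂, T₂) ∈ List.Nat.antidiagonal (S₂ + T₂, S₃ + T₃).1 := by simp only [List.Nat.mem_antidiagonal]
  have hs₃ : (S₃, T₃) ∈ List.Nat.antidiagonal (S₂ + T₂, S₃ + T₃).2 := by simp only [List.Nat.mem_antidiagonal]
  rcases hAW with hW1 | hW1 <;> rcases hAX with hX1 | hX1
  · rcases three_set_table_7_7_pp _ hm₀ _ hm₁ _ hm₂ hW1 _ hq₀ _ hq₁ _ hq₂ _ hq₃ hB1W hB2W _ hn₀ _ hn₁ _ hn₂ hX1
        _ hs₀ _ hs₁ _ hs₂ _ hs₃ hB1X hB2X l with hk | hk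
    · exact false_of_kill3 E1 hk
    · exact false_of_kill3 E2 (hk l₂ hl₂)
  · rcases three_set_table_7_7_pm _ hm₀ _ hm₁ _ hm₂ hW1 _ hq₀ _ hq₁ _ hq₂ _ hq₃ hB1W hB2W _ hn₀ _ hn₁ _ hn₂ hX1
        _ hs₀ _ hs₁ _ hs₂ _ hs₃ hB1X hB2X l with hk | hk
    · exact false_of_kill3 E1 hk
    · exact false_of_kill3 E2 (hk l₂ hl₂)
  · rcases three_set_table_7_7_mp _ hm₀ _ hm₁ _ hm₂ hW1 _ hq₀ _ hq₁ _ hq₂ _ hq₃ hB1W hB2W _ hn₀ _ hn₁ _ hn₂ hX1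
        _ hs₀ _ hs₁ _ hs₂ _ hs₃ hB1X hB2X l with hk | hk
    · exact false_of_kill3 E1 hk
    · exact false_of_kill3 E2 (hk l₂ hl₂)
  · rcases three_set_table_7_7_mm _ hm₀ _ hm₁ _ hm₂ hW1 _ hq₀ _ hq₁ _ hq₂ _ hq₃ hB1W hB2W _ hn₀ _ hn₁ _ hn₂ hX1
        _ hs₀ _ hs₁ _ hs₂ _ hs₃ hB1X hB2X l with hk | hk
    · exact false_of_kill3 E1 hk
    · exact false_of_kill3 E2 (hk l₂ hl₂)

end Core

/-! ## The TPP statements -/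

section DihedralLike

variable {A : Type} [AddCommGroup A] [DecidableEq A] [Fintype A] {G : Type} [Group G] [DecidableEq G]
  {ρ τ : A → G} {c₀ : A} {S T U : Finset G}

open Literature.Combinatorics.Additive

/-- **No `(3,3 | 5,5 | e,e)` law triple over `A ↠ ℤ₄ × ℤ₄`.**  Dihedral-like `G` over `A` (any `c₀`), `Φ : A →+ ZMod 4 × ZMod 4`
onto; a TPP triple with `|S₀| = |S₁| = 3`, `|T₀| = |T₁| = 5`, `|U₀| = |U₁|`.  Then `3|S||T||U| + 8 ≠ 8|A|`. [folklore] -/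
theorem no_law_cube_35e_of_onto_z4z4
    (hρρ : ∀ a b, ρ a * ρ b = ρ (a + b)) (hρτ : ∀ a b, ρ a * τ b = τ (b - a))
    (hτρ : ∀ a b, τ a * ρ b = τ (a + b)) (hττ : ∀ a b, τ a * τ b = ρ (c₀ + b - a))
    (hρ : Function.Injective ρ) (hτ : Function.Injective τ) (hne : ∀ a b, ρ a ≠ τ b)
    (hsurj : ∀ g, (∃ a, ρ a = g) ∨ (∃ a, τ a = g))
    (Φ : A →+ ZMod 4 × ZMod 4) (hΦ : Function.Surjective Φ)
    (h : TripleProductProperty S T U)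
    (hS₀ : (univ.filter fun a : A => ρ a ∈ S).card = 3) (hS₁ : (univ.filter fun a : A => τ a ∈ S).card = 3)
    (hT₀ : (univ.filter fun a : A => ρ a ∈ T).card = 5) (hT₁ : (univ.filter fun a : A => τ a ∈ T).card = 5)
    (hU : (univ.filter fun a : A => ρ a ∈ U).card = (univ.filter fun a : A => τ a ∈ U).card)
    (hV : 3 * (S.card * T.card * U.card) + 8 = 8 * Fintype.card A) : False := by
  classical
  obtain ⟨W, X, Y, κ₁, κ₂, κ₃, x₀, hWc, hXc, -, -, i₁, i₂, i₃, d₁₂, d₁₃, d₂₃, hcover⟩ :=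
    cube_shifted_form_of_law hρρ hρτ hτρ hττ hρ hτ hne hsurj h (by rw [hS₀, hS₁]) (by rw [hT₀, hT₁]) hU hV
  rw [hS₀] at hWc
  rw [hT₀] at hXc
  exact no_cube_form_35_of_onto_z4z4 Φ hΦ hWc hXc i₁ i₂ i₃ d₁₂ d₁₃ d₂₃ hcover

/-- **No `(5,5 | 5,5 | e,e)` law triple over `A ↠ ℤ₄ × ℤ₄`.**  Dihedral-like `G` over `A` (any `c₀`), `Φ : A →+ ZMod 4 × ZMod 4`
onto; a TPP triple with `|S₀| = |S₁| = 5`, `|T₀| = |T₁| = 5`, `|U₀| = |U₁|`.  Then `3|S||T||U| + 8 ≠ 8|A|`. [folklore] -/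
theorem no_law_cube_55e_of_onto_z4z4
    (hρρ : ∀ a b, ρ a * ρ b = ρ (a + b)) (hρτ : ∀ a b, ρ a * τ b = τ (b - a))
    (hτρ : ∀ a b, τ a * ρ b = τ (a + b)) (hττ : ∀ a b, τ a * τ b = ρ (c₀ + b - a))
    (hρ : Function.Injective ρ) (hτ : Function.Injective τ) (hne : ∀ a b, ρ a ≠ τ b)
    (hsurj : ∀ g, (∃ a, ρ a = g) ∨ (∃ a, τ a = g))
    (Φ : A →+ ZMod 4 × ZMod 4) (hΦ : Function.Surjective Φ)
    (h : TripleProductProperty S T U)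
    (hS₀ : (univ.filter fun a : A => ρ a ∈ S).card = 5) (hS₁ : (univ.filter fun a : A => τ a ∈ S).card = 5)
    (hT₀ : (univ.filter fun a : A => ρ a ∈ T).card = 5) (hT₁ : (univ.filter fun a : A => τ a ∈ T).card = 5)
    (hU : (univ.filter fun a : A => ρ a ∈ U).card = (univ.filter fun a : A => τ a ∈ U).card)
    (hV : 3 * (S.card * T.card * U.card) + 8 = 8 * Fintype.card A) : False := by
  classical
  obtain ⟨W, X, Y, κ₁, κ₂, κ₃, x₀, hWc, hXc, -, -, i₁, i₂, i₃, d₁₂, d₁₃, d₂₃, hcover⟩ :=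
    cube_shifted_form_of_law hρρ hρτ hτρ hττ hρ hτ hne hsurj h (by rw [hS₀, hS₁]) (by rw [hT₀, hT₁]) hU hV
  rw [hS₀] at hWc
  rw [hT₀] at hXc
  exact no_cube_form_55_of_onto_z4z4 Φ hΦ hWc hXc i₁ i₂ i₃ d₁₂ d₁₃ d₂₃ hcover

/-- **No `(7,7 | 7,7 | e,e)` law triple over `A ↠ ℤ₄ × ℤ₄`.**  Dihedral-like `G` over `A` (any `c₀`), `Φ : A →+ ZMod 4 × ZMod 4`
onto; a TPP triple with `|S₀| = |S₁| = 7`, `|T₀| = |T₁| = 7`, `|U₀| = |U₁|`.  Then `3|S||T||U| + 8 ≠ 8|A|`. [folklore] -/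
theorem no_law_cube_77e_of_onto_z4z4
    (hρρ : ∀ a b, ρ a * ρ b = ρ (a + b)) (hρτ : ∀ a b, ρ a * τ b = τ (b - a))
    (hτρ : ∀ a b, τ a * ρ b = τ (a + b)) (hττ : ∀ a b, τ a * τ b = ρ (c₀ + b - a))
    (hρ : Function.Injective ρ) (hτ : Function.Injective τ) (hne : ∀ a b, ρ a ≠ τ b)
    (hsurj : ∀ g, (∃ a, ρ a = g) ∨ (∃ a, τ a = g))
    (Φ : A →+ ZMod 4 × ZMod 4) (hΦ : Function.Surjective Φ)
    (h : TripleProductProperty S T U)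
    (hS₀ : (univ.filter fun a : A => ρ a ∈ S).card = 7) (hS₁ : (univ.filter fun a : A => τ a ∈ S).card = 7)
    (hT₀ : (univ.filter fun a : A => ρ a ∈ T).card = 7) (hT₁ : (univ.filter fun a : A => τ a ∈ T).card = 7)
    (hU : (univ.filter fun a : A => ρ a ∈ U).card = (univ.filter fun a : A => τ a ∈ U).card)
    (hV : 3 * (S.card * T.card * U.card) + 8 = 8 * Fintype.card A) : False := by
  classical
  obtain ⟨W, X, Y, κ₁, κ₂, κ₃, x₀, hWc, hXc, -, -, i₁, i₂, i₃, d₁₂, d₁₃, d₂₃, hcover⟩ :=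
    cube_shifted_form_of_law hρρ hρτ hτρ hττ hρ hτ hne hsurj h (by rw [hS₀, hS₁]) (by rw [hT₀, hT₁]) hU hV
  rw [hS₀] at hWc
  rw [hT₀] at hXc
  exact no_cube_form_77_of_onto_z4z4 Φ hΦ hWc hXc i₁ i₂ i₃ d₁₂ d₁₃ d₂₃ hcover

omit [AddCommGroup A] [DecidableEq A] in
/-- **All orderings.**  If the shape with `ρ`-parts `(p, q, ·)` (in the order `S, T, U`) is excluded for every TPP triple
of a fixed dihedral-like group, then so is every triple with balanced coset parts having a part `p` and ANOTHER part `q`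
in any two of `S, T, U` (`TripleProductProperty.rotate`, `tpp_reverse`). [folklore] -/
theorem no_law_cube_two_parts_of_ordered (p q : ℕ)
    (core : ∀ {S T U : Finset G}, TripleProductProperty S T U →
      (univ.filter fun a : A => ρ a ∈ S).card = p → (univ.filter fun a : A => τ a ∈ S).card = p →
      (univ.filter fun a : A => ρ a ∈ T).card = q → (univ.filter fun a : A => τ a ∈ T).card = q →
      (univ.filter fun a : A => ρ a ∈ U).card = (univ.filter fun a : A => τ a ∈ U).card →
      3 * (S.card * T.card * U.card) + 8 = 8 * Fintype.card A → False)
    (h : TripleProductProperty S T U)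
    (hS : (univ.filter fun a : A => ρ a ∈ S).card = (univ.filter fun a : A => τ a ∈ S).card)
    (hT : (univ.filter fun a : A => ρ a ∈ T).card = (univ.filter fun a : A => τ a ∈ T).card)
    (hU : (univ.filter fun a : A => ρ a ∈ U).card = (univ.filter fun a : A => τ a ∈ U).card)
    (hpq : ((univ.filter fun a : A => ρ a ∈ S).card = p ∧ (univ.filter fun a : A => ρ a ∈ T).card = q) ∨
      ((univ.filter fun a : A => ρ a ∈ T).card = p ∧ (univ.filter fun a : A => ρ a ∈ U).card = q) ∨
      ((univ.filter fun a : A => ρ a ∈ U).card = p ∧ (univ.filter fun a : A => ρ a ∈ S).card = q) ∨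
      ((univ.filter fun a : A => ρ a ∈ S).card = q ∧ (univ.filter fun a : A => ρ a ∈ T).card = p) ∨
      ((univ.filter fun a : A => ρ a ∈ T).card = q ∧ (univ.filter fun a : A => ρ a ∈ U).card = p) ∨
      ((univ.filter fun a : A => ρ a ∈ U).card = q ∧ (univ.filter fun a : A => ρ a ∈ S).card = p)) :
    3 * (S.card * T.card * U.card) + 8 ≠ 8 * Fintype.card A := by
  intro hV
  rcases hpq with ⟨h1, h2⟩ | ⟨h1, h2⟩ | ⟨h1, h2⟩ | ⟨h1, h2⟩ | ⟨h1, h2⟩ | ⟨h1, h2⟩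
  · exact core h h1 (hS ▸ h1) h2 (hT ▸ h2) hU hV
  · exact core h.rotate h1 (hT ▸ h1) h2 (hU ▸ h2) hS (by rw [← hV]; ring)
  · exact core h.rotate.rotate h1 (hU ▸ h1) h2 (hS ▸ h2) hT (by rw [← hV]; ring)
  · exact core (tpp_reverse h.rotate.rotate) h2 (hT ▸ h2) h1 (hS ▸ h1) hU (by rw [← hV]; ring)
  · exact core (tpp_reverse h) h2 (hU ▸ h2) h1 (hT ▸ h1) hS (by rw [← hV]; ring)
  · exact core (tpp_reverse h.rotate) h2 (hS ▸ h2) h1 (hU ▸ h1) hT (by rw [← hV]; ring)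

/-- **Cell form `(3,5,·)`**: balanced coset parts, a part `3` and another part `5` (any positions) ⇒
`3|S||T||U| + 8 ≠ 8|A|` over `A ↠ ℤ₄ × ℤ₄`. [folklore] -/
theorem no_law_cube_three_five_of_onto_z4z4
    (hρρ : ∀ a b, ρ a * ρ b = ρ (a + b)) (hρτ : ∀ a b, ρ a * τ b = τ (b - a))
    (hτρ : ∀ a b, τ a * ρ b = τ (a + b)) (hττ : ∀ a b, τ a * τ b = ρ (c₀ + b - a))
    (hρ : Function.Injective ρ) (hτ : Function.Injective τ) (hne : ∀ a b, ρ a ≠ τ b)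
    (hsurj : ∀ g, (∃ a, ρ a = g) ∨ (∃ a, τ a = g))
    (Φ : A →+ ZMod 4 × ZMod 4) (hΦ : Function.Surjective Φ)
    (h : TripleProductProperty S T U)
    (hS : (univ.filter fun a : A => ρ a ∈ S).card = (univ.filter fun a : A => τ a ∈ S).card)
    (hT : (univ.filter fun a : A => ρ a ∈ T).card = (univ.filter fun a : A => τ a ∈ T).card)
    (hU : (univ.filter fun a : A => ρ a ∈ U).card = (univ.filter fun a : A => τ a ∈ U).card)
    (h35 : ((univ.filter fun a : A => ρ a ∈ S).card = 3 ∧ (univ.filter fun a : A => ρ a ∈ T).card = 5) ∨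
      ((univ.filter fun a : A => ρ a ∈ T).card = 3 ∧ (univ.filter fun a : A => ρ a ∈ U).card = 5) ∨
      ((univ.filter fun a : A => ρ a ∈ U).card = 3 ∧ (univ.filter fun a : A => ρ a ∈ S).card = 5) ∨
      ((univ.filter fun a : A => ρ a ∈ S).card = 5 ∧ (univ.filter fun a : A => ρ a ∈ T).card = 3) ∨
      ((univ.filter fun a : A => ρ a ∈ T).card = 5 ∧ (univ.filter fun a : A => ρ a ∈ U).card = 3) ∨
      ((univ.filter fun a : A => ρ a ∈ U).card = 5 ∧ (univ.filter fun a : A => ρ a ∈ S).card = 3)) :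
    3 * (S.card * T.card * U.card) + 8 ≠ 8 * Fintype.card A :=
  no_law_cube_two_parts_of_ordered 3 5
    (fun h' hS₀ hS₁ hT₀ hT₁ hU' hV => no_law_cube_35e_of_onto_z4z4 hρρ hρτ hτρ hττ hρ hτ hne hsurj Φ hΦ h'
      hS₀ hS₁ hT₀ hT₁ hU' hV) h hS hT hU h35

/-- **Cell form `(5,5,·)`**: balanced coset parts and two parts `5` ⇒ `3|S||T||U| + 8 ≠ 8|A|` over `A ↠ ℤ₄ × ℤ₄`.
[folklore] -/
theorem no_law_cube_five_five_of_onto_z4z4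
    (hρρ : ∀ a b, ρ a * ρ b = ρ (a + b)) (hρτ : ∀ a b, ρ a * τ b = τ (b - a))
    (hτρ : ∀ a b, τ a * ρ b = τ (a + b)) (hττ : ∀ a b, τ a * τ b = ρ (c₀ + b - a))
    (hρ : Function.Injective ρ) (hτ : Function.Injective τ) (hne : ∀ a b, ρ a ≠ τ b)
    (hsurj : ∀ g, (∃ a, ρ a = g) ∨ (∃ a, τ a = g))
    (Φ : A →+ ZMod 4 × ZMod 4) (hΦ : Function.Surjective Φ)
    (h : TripleProductProperty S T U)
    (hS : (univ.filter fun a : A => ρ a ∈ S).card = (univ.filter fun a : A => τ a ∈ S).card)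
    (hT : (univ.filter fun a : A => ρ a ∈ T).card = (univ.filter fun a : A => τ a ∈ T).card)
    (hU : (univ.filter fun a : A => ρ a ∈ U).card = (univ.filter fun a : A => τ a ∈ U).card)
    (h55 : ((univ.filter fun a : A => ρ a ∈ S).card = 5 ∧ (univ.filter fun a : A => ρ a ∈ T).card = 5) ∨
      ((univ.filter fun a : A => ρ a ∈ T).card = 5 ∧ (univ.filter fun a : A => ρ a ∈ U).card = 5) ∨
      ((univ.filter fun a : A => ρ a ∈ U).card = 5 ∧ (univ.filter fun a : A => ρ a ∈ S).card = 5)) :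
    3 * (S.card * T.card * U.card) + 8 ≠ 8 * Fintype.card A :=
  no_law_cube_two_parts_of_ordered 5 5
    (fun h' hS₀ hS₁ hT₀ hT₁ hU' hV => no_law_cube_55e_of_onto_z4z4 hρρ hρτ hτρ hττ hρ hτ hne hsurj Φ hΦ h'
      hS₀ hS₁ hT₀ hT₁ hU' hV) h hS hT hU
    (by rcases h55 with h1 | h1 | h1 <;> [exact Or.inl h1; exact Or.inr (Or.inl h1); exact Or.inr (Or.inr (Or.inl h1))])

/-- **Cell form `(7,7,·)`**: balanced coset parts and two parts `7` ⇒ `3|S||T||U| + 8 ≠ 8|A|` over `A ↠ ℤ₄ × ℤ₄`.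
[folklore] -/
theorem no_law_cube_seven_seven_of_onto_z4z4
    (hρρ : ∀ a b, ρ a * ρ b = ρ (a + b)) (hρτ : ∀ a b, ρ a * τ b = τ (b - a))
    (hτρ : ∀ a b, τ a * ρ b = τ (a + b)) (hττ : ∀ a b, τ a * τ b = ρ (c₀ + b - a))
    (hρ : Function.Injective ρ) (hτ : Function.Injective τ) (hne : ∀ a b, ρ a ≠ τ b)
    (hsurj : ∀ g, (∃ a, ρ a = g) ∨ (∃ a, τ a = g))
    (Φ : A →+ ZMod 4 × ZMod 4) (hΦ : Function.Surjective Φ)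
    (h : TripleProductProperty S T U)
    (hS : (univ.filter fun a : A => ρ a ∈ S).card = (univ.filter fun a : A => τ a ∈ S).card)
    (hT : (univ.filter fun a : A => ρ a ∈ T).card = (univ.filter fun a : A => τ a ∈ T).card)
    (hU : (univ.filter fun a : A => ρ a ∈ U).card = (univ.filter fun a : A => τ a ∈ U).card)
    (h77 : ((univ.filter fun a : A => ρ a ∈ S).card = 7 ∧ (univ.filter fun a : A => ρ a ∈ T).card = 7) ∨
      ((univ.filter fun a : A => ρ a ∈ T).card = 7 ∧ (univ.filter fun a : A => ρ a ∈ U).card = 7) ∨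
      ((univ.filter fun a : A => ρ a ∈ U).card = 7 ∧ (univ.filter fun a : A => ρ a ∈ S).card = 7)) :
    3 * (S.card * T.card * U.card) + 8 ≠ 8 * Fintype.card A :=
  no_law_cube_two_parts_of_ordered 7 7
    (fun h' hS₀ hS₁ hT₀ hT₁ hU' hV => no_law_cube_77e_of_onto_z4z4 hρρ hρτ hτρ hττ hρ hτ hne hsurj Φ hΦ h'
      hS₀ hS₁ hT₀ hT₁ hU' hV) h hS hT hU
    (by rcases h77 with h1 | h1 | h1 <;> [exact Or.inl h1; exact Or.inr (Or.inl h1); exact Or.inr (Or.inr (Or.inl h1))])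

end DihedralLike

end Summit.MatrixMultiplication.OmegaCensus
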